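import Summits.AtomisticToContinuum.FouriersLaw.Theorems.VanishingNoiseTransferNoisyFourierThomsonWitnessCostsSitesAux2
import Summits.AtomisticToContinuum.FouriersLaw.Theorems.VanishingNoiseTransferNoisyFourierThomsonWitnessParityAux2
import Summits.AtomisticToContinuum.FouriersLaw.Theorems.VanishingNoiseTransferNoisyFourierThomsonWitnessSites

/-!
# The site-structured costs of the Thomson witness, III: `v ∈ L²(μ_T)`, the costs (f) and (g), the neighbour sums
(`--supports` file for crux `VanishingNoiseTransfer.NoisyFourier`, stmt-AtomisticToContinuum-11977, line
`abel-storage-decay`, stub B `stub_bulkAbelGKPositivity`; part W5a "WitnessL2Sites", file 3 of 4)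

Setting as in parts I–II (`…CostsSitesAux1/2`); `v` is the Thomson witness (shared text of lead c7, written inline),
`F_m = momentumFlip m`.
* inputs from W3 (`…ThomsonWitnessSites`): the site regrouping `v = Σ_m p_m K_m` (`Algebra.thomsonWitness_eq_sum_sites`,
  the `K_m` there are literally the site coefficients of part I) and `v ∘ F_m − v = −2 p_m K_m`
  (`Algebra.thomsonWitness_momentumFlip_sub`);
* `memLp_thomsonWitness` — **`v ∈ L²(μ_T)`**; `integral_thomsonWitness_sq_eq` — PYTHAGORAS OVER THE SITES
  `∫ v² = Σ_m ∫ p_m² K_m²` (`p_m K_m` is `F_m`-odd and `F_{m'}`-even, W2's `integral_sq_sum_of_odd_even`);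
* `exists_thomsonWitness_site_costs` — **(f) `∫ v² dμ_T ≤ c (L − 1)` and (g) `Σ_m ∫ (v ∘ F_m − v)² dμ_T ≤ c (L − 1)`**
  for `L ≥ 2`, ONE constant `c = 8 T C_K` depending on `ω₂, lam, β, T` only (part II's site bound, `L ≤ 2(L − 1)`);
* the neighbour momentum sums `N_m = Σ_{j = m+1} p_j φ'(q_j − q_m) + Σ_{m = i+1} p_i φ'(q_m − q_i)` of `∂_{p_m} v`:
  continuity, growth `|N_m| ≤ 4(1 + 3β)(1 + H)`, and the uniform bound `∫ (2 p_m N_m)² dμ_T ≤ 48 β T²`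
  (`continuous_nbrSum`, `abs_nbrSum_le`, `integral_sq_snd_mul_nbrSum_le`).
Registered helper: `helper_thomsonWitnessSiteCostsFG`. All statements are [folklore]; axioms `propext`,
`Classical.choice`, `Quot.sound` only.
-/

noncomputable section

open MeasureTheory
open scoped BigOperators
open Literature.MathematicalPhysics.KineticTheory.HeatConduction
open Summit.AtomisticToContinuum.FouriersLaw.Theorems.ChainVariation (pinnedChain_abs_momentum_pow_le_all)
open Summit.AtomisticToContinuum.FouriersLaw.Theorems.NoisyFourier.ThomsonWitness.Algebra
  (contDiff_dphi_coord thomsonWitness_eq_sum_sites thomsonWitness_momentumFlip_sub)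
open Summit.AtomisticToContinuum.FouriersLaw.Theorems.NoisyFourier.ThomsonWitness.Moments
  (integrable_mul_snd_pow_of_abs_le integral_snd_sq_mul_snd_sq)

namespace Summit.AtomisticToContinuum.FouriersLaw.Theorems.NoisyFourier.ThomsonWitness.Costs

variable {L : ℕ} {ω₂ lam β γ : ℝ}

/-! ### The witness: `L²` membership, the costs (f) and (g) -/

section Witness

variable (hω : 0 < ω₂) (hl : 0 ≤ lam) (hβ : 0 ≤ β) (γ : ℝ) {T : ℝ} (hT : 0 < T)
include hω hl hβ hT

/-- **`v ∈ L²(μ_T)`** (conjunct 1 of the witness costs). [folklore] -/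
theorem memLp_thomsonWitness (L : ℕ) :
    MemLp (fun x : PhaseSpace L => ∑ i : Fin L, ∑ j : Fin L, if j.val = i.val + 1 then
        (x.2 i * (x.2 j ^ 2 * (-(6 * β * (x.1 j - x.1 i)) / (1 + 3 * β * (x.1 j - x.1 i) ^ 2) ^ 2) -
            partialQ j ((pinnedChain ω₂ lam β γ).hamiltonian L) x * (1 / (1 + 3 * β * (x.1 j - x.1 i) ^ 2))) +
          x.2 j * (x.2 i ^ 2 * (-(6 * β * (x.1 j - x.1 i)) / (1 + 3 * β * (x.1 j - x.1 i) ^ 2) ^ 2) +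
            partialQ i ((pinnedChain ω₂ lam β γ).hamiltonian L) x * (1 / (1 + 3 * β * (x.1 j - x.1 i) ^ 2))))
        else 0) 2 ((pinnedChain ω₂ lam β γ).gibbsMeasure L T) := by
  simp only [thomsonWitness_eq_sum_sites]
  exact memLp_finsetSum _ fun m _ => memLp_snd_mul_K hω hl hβ γ hT L m

/-- **Pythagoras over the sites**: `∫ v² dμ_T = Σ_m ∫ p_m² K_m² dμ_T` (`p_m K_m` is odd under `F_m`, even under
`F_{m'}`, `m' ≠ m`). [folklore] -/
theorem integral_thomsonWitness_sq_eq (L : ℕ) :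
    ∫ x, (∑ i : Fin L, ∑ j : Fin L, if j.val = i.val + 1 then
        (x.2 i * (x.2 j ^ 2 * (-(6 * β * (x.1 j - x.1 i)) / (1 + 3 * β * (x.1 j - x.1 i) ^ 2) ^ 2) -
            partialQ j ((pinnedChain ω₂ lam β γ).hamiltonian L) x * (1 / (1 + 3 * β * (x.1 j - x.1 i) ^ 2))) +
          x.2 j * (x.2 i ^ 2 * (-(6 * β * (x.1 j - x.1 i)) / (1 + 3 * β * (x.1 j - x.1 i) ^ 2) ^ 2) +
            partialQ i ((pinnedChain ω₂ lam β γ).hamiltonian L) x * (1 / (1 + 3 * β * (x.1 j - x.1 i) ^ 2))))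
        else 0) ^ 2 ∂((pinnedChain ω₂ lam β γ).gibbsMeasure L T) =
      ∑ m : Fin L, ∫ x, (x.2 m *
        ((∑ j : Fin L, if j.val = m.val + 1 then
          (x.2 j ^ 2 * (-(6 * β * (x.1 j - x.1 m)) / (1 + 3 * β * (x.1 j - x.1 m) ^ 2) ^ 2) -
            partialQ j ((pinnedChain ω₂ lam β γ).hamiltonian L) x * (1 / (1 + 3 * β * (x.1 j - x.1 m) ^ 2))) else 0) +
        (∑ i : Fin L, if m.val = i.val + 1 then
          (x.2 i ^ 2 * (-(6 * β * (x.1 m - x.1 i)) / (1 + 3 * β * (x.1 m - x.1 i) ^ 2) ^ 2) +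
            partialQ i ((pinnedChain ω₂ lam β γ).hamiltonian L) x * (1 / (1 + 3 * β * (x.1 m - x.1 i) ^ 2))) else 0))) ^ 2
        ∂((pinnedChain ω₂ lam β γ).gibbsMeasure L T) := by
  simp only [thomsonWitness_eq_sum_sites]
  set KF : Fin L → PhaseSpace L → ℝ := fun (m' : Fin L) (y : PhaseSpace L) =>
      (∑ j : Fin L, if j.val = m'.val + 1 then
        (y.2 j ^ 2 * (-(6 * β * (y.1 j - y.1 m')) / (1 + 3 * β * (y.1 j - y.1 m') ^ 2) ^ 2) -
          partialQ j ((pinnedChain ω₂ lam β γ).hamiltonian L) y * (1 / (1 + 3 * β * (y.1 j - y.1 m') ^ 2))) else 0) +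
      (∑ i : Fin L, if m'.val = i.val + 1 then
        (y.2 i ^ 2 * (-(6 * β * (y.1 m' - y.1 i)) / (1 + 3 * β * (y.1 m' - y.1 i) ^ 2) ^ 2) +
          partialQ i ((pinnedChain ω₂ lam β γ).hamiltonian L) y * (1 / (1 + 3 * β * (y.1 m' - y.1 i) ^ 2))) else 0)
    with hKF
  have hK : ∀ (m' m : Fin L) (x : PhaseSpace L), KF m' (momentumFlip m x) = KF m' x := fun m' m x =>
    K_momentumFlip (ω₂ := ω₂) (lam := lam) (β := β) (γ := γ) m' m x
  exact Parity.integral_sq_sum_of_odd_even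
    (fun m => (pinnedChain ω₂ lam β γ).measurePreserving_momentumFlip_gibbsMeasure L T m) (fun m x => x.2 m * KF m x)
    (fun m => memLp_snd_mul_K hω hl hβ γ hT L m)
    (fun m x => Parity.odd_snd_mul_of_even m (g := KF m) (fun y => hK m m y) x)
    (fun m m' hmm' x => Parity.even_snd_mul_of_even (Ne.symm hmm') (g := KF m') (fun y => hK m' m y) x)

/-- **The site costs (f) and (g)**: with ONE constant `c = 8 T C_K` (depending on `ω₂, lam, β, T` only), for every
`L ≥ 2`, `∫ v² dμ_T ≤ c (L − 1)` and `Σ_m ∫ (v ∘ F_m − v)² dμ_T ≤ c (L − 1)`. [folklore] -/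
theorem exists_thomsonWitness_site_costs : ∃ c : ℝ, 0 ≤ c ∧ ∀ (L : ℕ), 2 ≤ L →
    ∫ x, (∑ i : Fin L, ∑ j : Fin L, if j.val = i.val + 1 then
        (x.2 i * (x.2 j ^ 2 * (-(6 * β * (x.1 j - x.1 i)) / (1 + 3 * β * (x.1 j - x.1 i) ^ 2) ^ 2) -
            partialQ j ((pinnedChain ω₂ lam β γ).hamiltonian L) x * (1 / (1 + 3 * β * (x.1 j - x.1 i) ^ 2))) +
          x.2 j * (x.2 i ^ 2 * (-(6 * β * (x.1 j - x.1 i)) / (1 + 3 * β * (x.1 j - x.1 i) ^ 2) ^ 2) +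
            partialQ i ((pinnedChain ω₂ lam β γ).hamiltonian L) x * (1 / (1 + 3 * β * (x.1 j - x.1 i) ^ 2))))
        else 0) ^ 2 ∂((pinnedChain ω₂ lam β γ).gibbsMeasure L T) ≤ c * ((L : ℝ) - 1) ∧
    ∑ m : Fin L, ∫ x, ((fun y : PhaseSpace L => ∑ i : Fin L, ∑ j : Fin L, if j.val = i.val + 1 then
        (y.2 i * (y.2 j ^ 2 * (-(6 * β * (y.1 j - y.1 i)) / (1 + 3 * β * (y.1 j - y.1 i) ^ 2) ^ 2) -
            partialQ j ((pinnedChain ω₂ lam β γ).hamiltonian L) y * (1 / (1 + 3 * β * (y.1 j - y.1 i) ^ 2))) +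
          y.2 j * (y.2 i ^ 2 * (-(6 * β * (y.1 j - y.1 i)) / (1 + 3 * β * (y.1 j - y.1 i) ^ 2) ^ 2) +
            partialQ i ((pinnedChain ω₂ lam β γ).hamiltonian L) y * (1 / (1 + 3 * β * (y.1 j - y.1 i) ^ 2))))
        else 0) (momentumFlip m x) -
      (∑ i : Fin L, ∑ j : Fin L, if j.val = i.val + 1 then
        (x.2 i * (x.2 j ^ 2 * (-(6 * β * (x.1 j - x.1 i)) / (1 + 3 * β * (x.1 j - x.1 i) ^ 2) ^ 2) -
            partialQ j ((pinnedChain ω₂ lam β γ).hamiltonian L) x * (1 / (1 + 3 * β * (x.1 j - x.1 i) ^ 2))) +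
          x.2 j * (x.2 i ^ 2 * (-(6 * β * (x.1 j - x.1 i)) / (1 + 3 * β * (x.1 j - x.1 i) ^ 2) ^ 2) +
            partialQ i ((pinnedChain ω₂ lam β γ).hamiltonian L) x * (1 / (1 + 3 * β * (x.1 j - x.1 i) ^ 2))))
        else 0)) ^ 2 ∂((pinnedChain ω₂ lam β γ).gibbsMeasure L T) ≤ c * ((L : ℝ) - 1) := by
  obtain ⟨C, hC0, hC⟩ := exists_integral_sq_snd_mul_K_le hω hl hβ γ hT
  refine ⟨8 * C, by positivity, fun L hL => ?_⟩
  have hL' : (L : ℝ) ≤ 2 * ((L : ℝ) - 1) := by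
    have : (2 : ℝ) ≤ L := by exact_mod_cast hL
    linarith
  have hsum : ∑ m : Fin L, ∫ x, (x.2 m *
        ((∑ j : Fin L, if j.val = m.val + 1 then
          (x.2 j ^ 2 * (-(6 * β * (x.1 j - x.1 m)) / (1 + 3 * β * (x.1 j - x.1 m) ^ 2) ^ 2) -
            partialQ j ((pinnedChain ω₂ lam β γ).hamiltonian L) x * (1 / (1 + 3 * β * (x.1 j - x.1 m) ^ 2))) else 0) +
        (∑ i : Fin L, if m.val = i.val + 1 then
          (x.2 i ^ 2 * (-(6 * β * (x.1 m - x.1 i)) / (1 + 3 * β * (x.1 m - x.1 i) ^ 2) ^ 2) +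
            partialQ i ((pinnedChain ω₂ lam β γ).hamiltonian L) x * (1 / (1 + 3 * β * (x.1 m - x.1 i) ^ 2))) else 0))) ^ 2
        ∂((pinnedChain ω₂ lam β γ).gibbsMeasure L T) ≤ C * L := by
    calc _ ≤ ∑ _m : Fin L, C := Finset.sum_le_sum fun m _ => hC L m
      _ = C * L := by simp [mul_comm]
  constructor
  · rw [integral_thomsonWitness_sq_eq hω hl hβ γ hT L]
    nlinarith
  · set KF : Fin L → PhaseSpace L → ℝ := fun (m' : Fin L) (y : PhaseSpace L) =>
      (∑ j : Fin L, if j.val = m'.val + 1 then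
        (y.2 j ^ 2 * (-(6 * β * (y.1 j - y.1 m')) / (1 + 3 * β * (y.1 j - y.1 m') ^ 2) ^ 2) -
          partialQ j ((pinnedChain ω₂ lam β γ).hamiltonian L) y * (1 / (1 + 3 * β * (y.1 j - y.1 m') ^ 2))) else 0) +
      (∑ i : Fin L, if m'.val = i.val + 1 then
        (y.2 i ^ 2 * (-(6 * β * (y.1 m' - y.1 i)) / (1 + 3 * β * (y.1 m' - y.1 i) ^ 2) ^ 2) +
          partialQ i ((pinnedChain ω₂ lam β γ).hamiltonian L) y * (1 / (1 + 3 * β * (y.1 m' - y.1 i) ^ 2))) else 0)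
      with hKF
    set μ := (pinnedChain ω₂ lam β γ).gibbsMeasure L T with hμ
    have e : ∀ m : Fin L, ∫ x, (-2 * (x.2 m * KF m x)) ^ 2 ∂μ = 4 * ∫ x, (x.2 m * KF m x) ^ 2 ∂μ := fun m => by
      rw [← integral_const_mul]
      exact integral_congr_ae (ae_of_all _ fun x => by ring)
    have hsum' : ∑ m : Fin L, ∫ x, (x.2 m * KF m x) ^ 2 ∂μ ≤ C * L := hsum
    calc _ = ∑ m : Fin L, ∫ x, (-2 * (x.2 m * KF m x)) ^ 2 ∂μ :=
          Finset.sum_congr rfl fun m _ => integral_congr_ae (ae_of_all _ fun x =>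
            congrArg (fun r : ℝ => r ^ 2) (thomsonWitness_momentumFlip_sub (ω₂ := ω₂) (lam := lam) (γ := γ) m x))
      _ = 4 * ∑ m : Fin L, ∫ x, (x.2 m * KF m x) ^ 2 ∂μ := by rw [Finset.mul_sum]; exact Finset.sum_congr rfl fun m _ => e m
      _ ≤ 4 * (C * L) := by linarith
      _ ≤ 8 * C * ((L : ℝ) - 1) := by nlinarith

end Witness

/-! ### The neighbour momentum sums `N_m = Σ_{j=m+1} p_j φ'(r_{mj}) + Σ_{m=i+1} p_i φ'(r_{im})` of `∂_{p_m} v` -/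

section Neighbour

/-- `N_m` is continuous (`β ≥ 0`). [folklore] -/
theorem continuous_nbrSum (hβ : 0 ≤ β) (m : Fin L) : Continuous fun x : PhaseSpace L =>
    (∑ j : Fin L, if j.val = m.val + 1 then
        x.2 j * (-(6 * β * (x.1 j - x.1 m)) / (1 + 3 * β * (x.1 j - x.1 m) ^ 2) ^ 2) else 0) +
      (∑ i : Fin L, if m.val = i.val + 1 then
        x.2 i * (-(6 * β * (x.1 m - x.1 i)) / (1 + 3 * β * (x.1 m - x.1 i) ^ 2) ^ 2) else 0) := by
  refine (continuous_finsetSum _ fun j _ => ?_).add (continuous_finsetSum _ fun i _ => ?_)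
  · by_cases h : j.val = m.val + 1
    · simp only [h, if_true]
      exact ((continuous_apply j).comp continuous_snd).mul (contDiff_dphi_coord hβ m j (n := 0)).continuous
    · simp only [h, if_false]
      exact continuous_const
  · by_cases h : m.val = i.val + 1
    · simp only [h, if_true]
      exact ((continuous_apply i).comp continuous_snd).mul (contDiff_dphi_coord hβ i m (n := 0)).continuous
    · simp only [h, if_false]
      exact continuous_const

variable (hω : 0 < ω₂) (hl : 0 ≤ lam) (hβ : 0 ≤ β) (γ : ℝ)
include hω hl hβ

/-- Growth of the momentum-derivative atoms `p_j φ'(q_j - q_i)`: `|p_j φ'| ≤ 2(1 + 3β)(1 + H)`. [folklore] -/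
theorem abs_snd_mul_dphi_le (x : PhaseSpace L) (i j k : Fin L) :
    |x.2 k * (-(6 * β * (x.1 j - x.1 i)) / (1 + 3 * β * (x.1 j - x.1 i) ^ 2) ^ 2)| ≤
      2 * (1 + 3 * β) * (1 + (pinnedChain ω₂ lam β γ).hamiltonian L x) := by
  rw [abs_mul]
  have hp := abs_snd_le hω hl hβ γ x k
  have hd := abs_dphi_le hβ (x.1 j - x.1 i)
  calc _ ≤ 2 * (1 + (pinnedChain ω₂ lam β γ).hamiltonian L x) * (1 + 3 * β) :=
        mul_le_mul hp hd (abs_nonneg _) (by linarith [one_le_one_add_hamiltonian hω hl hβ γ x])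
    _ = _ := by ring

/-- Growth of `N_m`: `|N_m| ≤ 4(1 + 3β)(1 + H)`. [folklore] -/
theorem abs_nbrSum_le (m : Fin L) (x : PhaseSpace L) :
    |(∑ j : Fin L, if j.val = m.val + 1 then
        x.2 j * (-(6 * β * (x.1 j - x.1 m)) / (1 + 3 * β * (x.1 j - x.1 m) ^ 2) ^ 2) else 0) +
      (∑ i : Fin L, if m.val = i.val + 1 then
        x.2 i * (-(6 * β * (x.1 m - x.1 i)) / (1 + 3 * β * (x.1 m - x.1 i) ^ 2) ^ 2) else 0)| ≤
      4 * (1 + 3 * β) * (1 + (pinnedChain ω₂ lam β γ).hamiltonian L x) := by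
  have hM := one_le_one_add_hamiltonian hω hl hβ γ x (L := L)
  have h0 : (0 : ℝ) ≤ 2 * (1 + 3 * β) * (1 + (pinnedChain ω₂ lam β γ).hamiltonian L x) := by positivity
  rw [sum_ite_succ_eq, sum_ite_pred_eq]
  refine (abs_add_le _ _).trans ?_
  have h1 : |(if h : m.val + 1 < L then x.2 ⟨m.val + 1, h⟩ *
      (-(6 * β * (x.1 ⟨m.val + 1, h⟩ - x.1 m)) / (1 + 3 * β * (x.1 ⟨m.val + 1, h⟩ - x.1 m) ^ 2) ^ 2) else 0)| ≤
      2 * (1 + 3 * β) * (1 + (pinnedChain ω₂ lam β γ).hamiltonian L x) := by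
    split_ifs with h
    · exact abs_snd_mul_dphi_le hω hl hβ γ x m _ _
    · rw [abs_zero]; exact h0
  have h2 : |(if h : 1 ≤ m.val then x.2 ⟨m.val - 1, by omega⟩ *
      (-(6 * β * (x.1 m - x.1 ⟨m.val - 1, by omega⟩)) / (1 + 3 * β * (x.1 m - x.1 ⟨m.val - 1, by omega⟩) ^ 2) ^ 2)
      else 0)| ≤ 2 * (1 + 3 * β) * (1 + (pinnedChain ω₂ lam β γ).hamiltonian L x) := by
    split_ifs with h
    · exact abs_snd_mul_dphi_le hω hl hβ γ x _ m _
    · rw [abs_zero]; exact h0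
  linarith

variable {T : ℝ} (hT : 0 < T)
include hT

/-- **Uniform bound on the extra term of `∂_{p_m} v`**: `∫ (2 p_m N_m)² dμ_T ≤ 48 β T²` for every `L`, `m`
(`φ'² ≤ 3β`, `∫ p_m² p_{m±1}² dμ_T = T²`). [folklore] -/
theorem integral_sq_snd_mul_nbrSum_le (L : ℕ) (m : Fin L) :
    Integrable (fun x : PhaseSpace L => (2 * x.2 m *
      ((∑ j : Fin L, if j.val = m.val + 1 then
        x.2 j * (-(6 * β * (x.1 j - x.1 m)) / (1 + 3 * β * (x.1 j - x.1 m) ^ 2) ^ 2) else 0) +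
      (∑ i : Fin L, if m.val = i.val + 1 then
        x.2 i * (-(6 * β * (x.1 m - x.1 i)) / (1 + 3 * β * (x.1 m - x.1 i) ^ 2) ^ 2) else 0))) ^ 2)
        ((pinnedChain ω₂ lam β γ).gibbsMeasure L T) ∧
    ∫ x, (2 * x.2 m *
      ((∑ j : Fin L, if j.val = m.val + 1 then
        x.2 j * (-(6 * β * (x.1 j - x.1 m)) / (1 + 3 * β * (x.1 j - x.1 m) ^ 2) ^ 2) else 0) +
      (∑ i : Fin L, if m.val = i.val + 1 then
        x.2 i * (-(6 * β * (x.1 m - x.1 i)) / (1 + 3 * β * (x.1 m - x.1 i) ^ 2) ^ 2) else 0))) ^ 2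
        ∂((pinnedChain ω₂ lam β γ).gibbsMeasure L T) ≤ 48 * β * T ^ 2 := by
  set μ := (pinnedChain ω₂ lam β γ).gibbsMeasure L T with hμ
  -- the one-neighbour pieces `p_m² (p_k φ'(·))² ≤ 3β p_k² p_m²`, `∫ = 3β T²`
  have hpair : ∀ (k a b : Fin L), k ≠ m →
      Integrable (fun x : PhaseSpace L => x.2 m ^ 2 *
        (x.2 k * (-(6 * β * (x.1 a - x.1 b)) / (1 + 3 * β * (x.1 a - x.1 b) ^ 2) ^ 2)) ^ 2) μ ∧
      ∫ x, x.2 m ^ 2 * (x.2 k * (-(6 * β * (x.1 a - x.1 b)) / (1 + 3 * β * (x.1 a - x.1 b) ^ 2) ^ 2)) ^ 2 ∂μ ≤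
        3 * β * T ^ 2 := by
    intro k a b hkm
    have hI : Integrable (fun x : PhaseSpace L => x.2 k ^ 2 * x.2 m ^ 2) μ :=
      integrable_mul_snd_pow_of_abs_le hω hl hβ γ hT L (g := fun z : PhaseSpace L => z.2 k ^ 2) (by fun_prop)
        (fun x => pinnedChain_abs_momentum_pow_le_all hω hl hβ γ L x k 2) m 2
    have hE : ∫ x, x.2 k ^ 2 * x.2 m ^ 2 ∂μ = T ^ 2 := integral_snd_sq_mul_snd_sq hω hl hβ γ hT L (Ne.symm hkm)
    have hc : Continuous fun x : PhaseSpace L => x.2 m ^ 2 *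
        (x.2 k * (-(6 * β * (x.1 a - x.1 b)) / (1 + 3 * β * (x.1 a - x.1 b) ^ 2) ^ 2)) ^ 2 :=
      (((continuous_apply m).comp continuous_snd).pow 2).mul
        ((((continuous_apply k).comp continuous_snd).mul (contDiff_dphi_coord hβ b a (n := 0)).continuous).pow 2)
    refine integrable_and_integral_le_of_le hc.aestronglyMeasurable (hI.const_mul (3 * β))
      (fun x => by positivity) (fun x => ?_) ?_
    · have hd := Xv.dphi_sq_le hβ (x.1 a - x.1 b)
      have h0 : 0 ≤ x.2 k ^ 2 * x.2 m ^ 2 := by positivity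
      calc x.2 m ^ 2 * (x.2 k * (-(6 * β * (x.1 a - x.1 b)) / (1 + 3 * β * (x.1 a - x.1 b) ^ 2) ^ 2)) ^ 2
          = (x.2 k ^ 2 * x.2 m ^ 2) * (-(6 * β * (x.1 a - x.1 b)) / (1 + 3 * β * (x.1 a - x.1 b) ^ 2) ^ 2) ^ 2 := by
            ring
        _ ≤ (x.2 k ^ 2 * x.2 m ^ 2) * (3 * β) := mul_le_mul_of_nonneg_left hd h0
        _ = 3 * β * (x.2 k ^ 2 * x.2 m ^ 2) := by ring
    · rw [integral_const_mul, hE]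
  -- the two guarded pieces
  set S₃ : PhaseSpace L → ℝ := fun x => ∑ j : Fin L, if j.val = m.val + 1 then
      x.2 j * (-(6 * β * (x.1 j - x.1 m)) / (1 + 3 * β * (x.1 j - x.1 m) ^ 2) ^ 2) else 0 with hS₃
  set S₄ : PhaseSpace L → ℝ := fun x => ∑ i : Fin L, if m.val = i.val + 1 then
      x.2 i * (-(6 * β * (x.1 m - x.1 i)) / (1 + 3 * β * (x.1 m - x.1 i) ^ 2) ^ 2) else 0 with hS₄
  have hI₃ : Integrable (fun x => x.2 m ^ 2 * S₃ x ^ 2) μ ∧ ∫ x, x.2 m ^ 2 * S₃ x ^ 2 ∂μ ≤ 3 * β * T ^ 2 := by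
    simp only [hS₃, sum_ite_succ_eq]
    split_ifs with h
    · exact hpair ⟨m.val + 1, h⟩ _ _ (fun e => by have := congrArg Fin.val e; simp at this)
    · simp only [ne_eq, OfNat.ofNat_ne_zero, not_false_eq_true, zero_pow, mul_zero, integral_zero]
      exact ⟨integrable_zero _ _ _, by positivity⟩
  have hI₄ : Integrable (fun x => x.2 m ^ 2 * S₄ x ^ 2) μ ∧ ∫ x, x.2 m ^ 2 * S₄ x ^ 2 ∂μ ≤ 3 * β * T ^ 2 := by
    simp only [hS₄, sum_ite_pred_eq]
    split_ifs with h
    · exact hpair ⟨m.val - 1, by omega⟩ _ _ (fun e => by have := congrArg Fin.val e; simp at this; omega)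
    · simp only [ne_eq, OfNat.ofNat_ne_zero, not_false_eq_true, zero_pow, mul_zero, integral_zero]
      exact ⟨integrable_zero _ _ _, by positivity⟩
  have hg : Integrable (fun x => 8 * (x.2 m ^ 2 * S₃ x ^ 2) + 8 * (x.2 m ^ 2 * S₄ x ^ 2)) μ :=
    (hI₃.1.const_mul 8).add (hI₄.1.const_mul 8)
  have hc : Continuous fun x : PhaseSpace L => (2 * x.2 m * (S₃ x + S₄ x)) ^ 2 :=
    ((continuous_const.mul ((continuous_apply m).comp continuous_snd)).mul (continuous_nbrSum hβ m)).pow 2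
  show Integrable (fun x => (2 * x.2 m * (S₃ x + S₄ x)) ^ 2) μ ∧ ∫ x, (2 * x.2 m * (S₃ x + S₄ x)) ^ 2 ∂μ ≤ 48 * β * T ^ 2
  refine integrable_and_integral_le_of_le hc.aestronglyMeasurable hg (fun x => sq_nonneg _) (fun x => ?_) ?_
  · show (2 * x.2 m * (S₃ x + S₄ x)) ^ 2 ≤ 8 * (x.2 m ^ 2 * S₃ x ^ 2) + 8 * (x.2 m ^ 2 * S₄ x ^ 2)
    nlinarith [sq_nonneg (x.2 m * (S₃ x - S₄ x))]
  · rw [integral_add (hI₃.1.const_mul 8) (hI₄.1.const_mul 8), integral_const_mul, integral_const_mul]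
    linarith [hI₃.2, hI₄.2]

end Neighbour

/-! ### Registered helper -/

/-- Registered helper sub-goal `helper_thomsonWitnessSiteCostsFG` of crux stmt-AtomisticToContinuum-11977 (line
`abel-storage-decay`, stub B `stub_bulkAbelGKPositivity`, part W5a): the site costs (f) `∫ v² dμ_T ≤ c (L − 1)` and
(g) `Σ_m ∫ (v ∘ F_m − v)² dμ_T ≤ c (L − 1)` of the Thomson witness, `L ≥ 2`, one constant `c = c(ω₂, lam, β, T)`
(`exists_thomsonWitness_site_costs`, restated notation-free). [folklore] -/
theorem helper_thomsonWitnessSiteCostsFG : ∀ (ω₂ lam β γ T : ℝ), 0 < ω₂ → 0 ≤ lam → 0 ≤ β → 0 < T → ∃ c : ℝ, 0 ≤ c ∧ ∀ (L : ℕ), 2 ≤ L → let v : Literature.MathematicalPhysics.KineticTheory.HeatConduction.PhaseSpace L → ℝ := fun x => ∑ i : Fin L, ∑ j : Fin L, if j.val = i.val + 1 then (x.2 i * (x.2 j ^ 2 * (-(6 * β * (x.1 j - x.1 i)) / (1 + 3 * β * (x.1 j - x.1 i) ^ 2) ^ 2) - Literature.MathematicalPhysics.KineticTheory.HeatConduction.partialQ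 j ((Literature.MathematicalPhysics.KineticTheory.HeatConduction.pinnedChain ω₂ lam β γ).hamiltonian L) x * (1 / (1 + 3 * β * (x.1 j - x.1 i) ^ 2))) + x.2 j * (x.2 i ^ 2 * (-(6 * β * (x.1 j - x.1 i)) / (1 + 3 * β * (x.1 j - x.1 i) ^ 2) ^ 2) + Literature.MathematicalPhysics.KineticTheory.HeatConduction.partialQ i ((Literature.MathematicalPhysics.KineticTheory.HeatConduction.pinnedChain ω₂ lam β γ).hamiltonian L) x * (1 / (1 + 3 * β * (x.1 j - x.1 i) ^ 2)))) else 0; MeasureTheory.integral ((Literature.MathematicalPhysics.KineticTheory.HeatConduction.pinnedChain ω₂ lam β γ).gibbsMeasure L T) (fun x => v x ^ 2) ≤ c * ((L : ℝ) - 1) ∧ ∑ m : Fin L, MeasureTheory.integral ((Literature.MathematicalPhysics.KineticTheory.HeatConduction.pinnedChain ω₂ lam β γ).gibbsMeasure L T) (fun x => (v (Literature.MathematicalPhysics.KineticTheory.HeatConduction.momentumFlip m x) - v x) ^ 2) ≤ c * ((L : ℝ) - 1) :=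
  fun _ _ _ γ _ hω hl hβ hT => exists_thomsonWitness_site_costs hω hl hβ γ hT

end Summit.AtomisticToContinuum.FouriersLaw.Theorems.NoisyFourier.ThomsonWitness.Costs

end
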